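import Literature.MathematicalPhysics.QuantumLattice.SectorisedIncrementBoundDBPlateau
import Literature.MathematicalPhysics.QuantumLattice.GrassmannEffectiveActionGradedLipschitzDB
import HarnessLib

/-!
# The orders `≥ 2` of the sectorised single-scale INCREMENT are LIPSCHITZ in the input, GRADED and TELESCOPED, plateau transport:
# the difference `(effAction C G − e^{Δ_C} G) − (effAction C G′ − e^{Δ_C} G′)` of two inputs across the SAME slice

Topic `MathematicalPhysics/QuantumLattice`; the two-input (Lipschitz) twin of `SectorisedIncrementBoundGradedPlateau` (one input: the orders
`2 ≤ n < N₀` of `effAction C G − e^{Δ_C} G` in PRODUCT form on the leg constraint `m + 1 + 2(n−1) ≤ Σ_a 2δ_a`, the orders `≥ N₀` as the flat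
tail `θ^{N₀−1}`, read through a substitution `f` and an analysis map `g` and transported to the Hubbard torus by the plateau machinery), built
on the abstract telescoped step `GrassmannEffectiveActionGradedLipschitzDB.sum_norm_kernel_effAction_sub_gaussConv_sub_le_graded_of_gramBounded`
(two even interactions with a COMMON majorant profile `μ̄` and a difference profile `ν̄`; every order-`n` term is multilinear in its `n` inputs, so
`T(V,…,V) − T(V′,…,V′) = Σ_a T(V′,…,V−V′,…,V)`: ONE slot carries `ν̄`, the others `μ̄`; Benfatto–Giuliani–Mastropietro 2006 (2.13)–(2.14),
(2.61)–(2.63), (2.66), (2.70)–(2.71a), (2.76)–(2.83), (2.87)–(2.90); Gawȩdzki–Kupiainen 1985 §3 — the contraction of the single-scale map in the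
irrelevant directions, read on DIFFERENCES).  This is the one-level bound a BLOCKED birth-level iteration of single-scale steps consumes for
TWO data sets flowing across the same covariances (two volumes after transfer to a common algebra, two cutoffs, two boundary data): cell
gate-hubbard-kl, K3 engine child, the hypothesis `(hstep)` of the dimensionless LIPSCHITZ tower `towerBornDiff_le_law₄` / `towerLipStep_le_of_chernoff`
in MODEL currency, orders `≥ 2` — its inner index sum is the mixed graded sum `towerSLip` (one output unit pulled out) after the index-set glue
`sum_range_filter_sum_mul_prod_erase_eq_towerSLip`.

* §1 (generic label sets) **`kernelNorm_kernel_map_effAction_sub_gaussConv_sub_le_graded_of_gramBounded`** — two even inputs `Ṽ, Ṽ′` without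
  constant part on `Γ′`, the SAME `C`, `f`, `g`; profiles `‖kernel_{2m′} Ṽ‖₁, ‖kernel_{2m′} Ṽ′‖₁ ≤ μ̄(m′)`, `‖kernel_{2m′} (Ṽ − Ṽ′)‖₁ ≤ ν̄(m′)`,
  `θ̄ = eα‖μ̄‖_h/κ² < 1`; then in every degree `m + 1`,
  `‖kernel_{m+1} (map g ((effAction C V − e^{Δ_C}V) − (effAction C V′ − e^{Δ_C}V′)))‖_ε ≤
     cr·cc^m·ε^m·[ Σ_{n=2}^{N₀−1} ρ^{-(m+1)} κ^{-2(n−1)} α^{n−1} eⁿ · Σ_{δ ∈ [0,|Γ′|/2]^n, m+1+2(n−1) ≤ Σ 2δ_a} Σ_a g_ν̄(δ_a)·Π_{b≠a} g_μ̄(δ_b)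
       + 2·ρ^{-(m+1)} e‖μ̄‖_h θ̄^{N₀−1}/(1−θ̄) ]`, `g_ν̄(d) = (e²(κ+ρ))^{2d} ν̄(d)`, `g_μ̄(d) = (e²(κ+ρ))^{2d} μ̄(d)`, `V = map f Ṽ`, `V′ = map f Ṽ′`;
* §2 (Hubbard torus, plateau transfer; private helpers: the sector preimage is linear in `G`)
  **`hubbardSectorKernelNorm_effAction_sub_gaussConv_sub_le_graded_of_gramBounded_of_plateau`** — two even inputs `G, G′` of the Hubbard torus
  without constant part, the same thin/fat pair `F, F̃`, output family `F′`, covariance `C` with the plateau of `F` over `supp C` and over `F′`;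
  profiles in the sectorised currency of the INPUT family: `ε_x‖G‖_{F,univ,2m′}, ε_x‖G′‖_{F,univ,2m′} ≤ μ̄(m′)`, `ε_x‖G − G′‖_{F,univ,2m′} ≤ ν̄(m′)`;
  the same right side in every degree `m + 1` and every constraint set `A` for `‖(effAction C G − e^{Δ_C}G) − (effAction C G′ − e^{Δ_C}G′)‖_{F′,A,m+1}`;
* §3 (first order) **`hubbardSectorKernelNorm_gaussConv_sub_sub_le_binomial_of_gramBounded_of_plateau`** — `e^{Δ_C}` is linear, so the first
  order of the difference is the binomial–Gram first-order door of `SectorisedIncrementBoundDBPlateau` at the input `G − G′`: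
  `‖(e^{Δ_C}G − G) − (e^{Δ_C}G′ − G′)‖_{F′,A,2p} ≤ cr·cc^{2p−1}·ε_x^{2p−1}·Σ_{m′>p} C(2m′,2p) κ^{2m′−2p} ε_x‖G − G′‖_{F,univ,2m′}`.

Everything is proved; no definition, no named fact.  NOT here: the prescribed-leg (levels) twin (separate file, same text on
`GrassmannEffectiveActionGradedLipschitzPrescribedDB`), the weighted twin, and every model constant.

## Sources

G. Benfatto, A. Giuliani, V. Mastropietro, Ann. Henri Poincaré 7 (2006) 809–898, (2.13)–(2.14), (2.61)–(2.63), (2.66), (2.70)–(2.71a),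
(2.76)–(2.83), (2.87)–(2.90) [`BenfattoGiulianiMastropietro2006`]; W. de Siqueira Pedra, M. Salmhofer, Comm. Math. Phys. 282 (2008) 797–818,
Thm 1.3 [`PedraSalmhofer2008`]; K. Gawȩdzki, A. Kupiainen, Comm. Math. Phys. 102 (1985) 1–30, §3 [`GawedzkiKupiainen1985GrossNeveu`].
-/

noncomputable section

namespace Literature.MathematicalPhysics.QuantumLattice

open GrassmannAlgebra Finset Literature.Probability.LatticeModels
open scoped Nat

universe u

/-! ### §1 Generic label sets: the graded telescoped orders `≥ 2` of the increment DIFFERENCE read through `(f, g)` -/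

section Generic

variable {𝕜 : Type*} [RCLike 𝕜] {Γ Γ' Γ'' : Type u} [Fintype Γ] [DecidableEq Γ] [Fintype Γ'] [DecidableEq Γ']
  [Fintype Γ''] [DecidableEq Γ'']

omit [Fintype Γ'] [DecidableEq Γ'] in
/-- Kernels of a difference. [folklore] -/
private theorem kernel_sub_eq (A B : GrassmannAlgebra 𝕜 Γ') (m : ℕ) (X : Fin m → Γ') :
    kernel 𝕜 (A - B) m X = kernel 𝕜 A m X - kernel 𝕜 B m X := by
  rw [sub_eq_add_neg, kernel_add, ← neg_one_smul 𝕜 B, kernel_smul, neg_one_mul, ← sub_eq_add_neg]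

/-- **Orders `≥ 2` of the increment DIFFERENCE of two inputs, read through `(f, g)`, GRADED and TELESCOPED** (BGM 2006 (2.61)–(2.63),
(2.66), (2.77)–(2.83), (2.87)–(2.90); Gawȩdzki–Kupiainen 1985, §3): `Ṽ, Ṽ′` even without constant part, `C′ = fᵀ C f` replica-Gram-bounded
(`κ > 0`) with row/column sums `≤ α`, a COMMON majorant profile `μ̄ ≥ 0` of `‖kernel_{2m′} Ṽ‖₁` and `‖kernel_{2m′} Ṽ′‖₁` and a difference profile
`ν̄ ≥ 0` of `‖kernel_{2m′} (Ṽ − Ṽ′)‖₁`, `θ̄ = eα‖μ̄‖_h/κ² < 1`, analysis costs `(cr, cc)` of `g ∘ f`, truncation order `N₀ ≥ 2`; then in every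
degree `m + 1`, with `V = map f Ṽ`, `V′ = map f Ṽ′`,
`‖kernel_{m+1} (map g ((effAction C V − e^{Δ_C}V) − (effAction C V′ − e^{Δ_C}V′)))‖_ε ≤
  cr·cc^m·ε^m·[Σ_{n=2}^{N₀−1} ρ^{-(m+1)} κ^{-2(n−1)} α^{n−1} eⁿ Σ_{δ, m+1+2(n−1) ≤ Σ 2δ_a} Σ_a g_ν̄(δ_a) Π_{b≠a} g_μ̄(δ_b) + 2ρ^{-(m+1)} e‖μ̄‖_h θ̄^{N₀−1}/(1−θ̄)]`
— ONE slot carries the difference profile, the others the common majorant; the leg constraint is kept order by order.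
[cite: BenfattoGiulianiMastropietro2006, (2.61)-(2.63), (2.66), (2.87)-(2.90)] -/
theorem kernelNorm_kernel_map_effAction_sub_gaussConv_sub_le_graded_of_gramBounded
    (C : Matrix Γ Γ 𝕜) (f : (Γ' → 𝕜) →ₗ[𝕜] (Γ → 𝕜)) (g : (Γ → 𝕜) →ₗ[𝕜] (Γ'' → 𝕜))
    (Vt Vt' : GrassmannAlgebra 𝕜 Γ') (hVt : Vt ∈ evenPart 𝕜 Γ') (hVt' : Vt' ∈ evenPart 𝕜 Γ') (hVt0 : constPart 𝕜 Vt = 0)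
    (hVt'0 : constPart 𝕜 Vt' = 0) (μ ν : ℕ → ℝ) (hμ0 : ∀ m', 0 ≤ μ m') (hν0 : ∀ m', 0 ≤ ν m')
    (hμ : ∀ m', kernelNorm 1 (2 * m') (kernel 𝕜 Vt (2 * m')) ≤ μ m')
    (hμ' : ∀ m', kernelNorm 1 (2 * m') (kernel 𝕜 Vt' (2 * m')) ≤ μ m')
    (hν : ∀ m', kernelNorm 1 (2 * m') (kernel 𝕜 (Vt - Vt') (2 * m')) ≤ ν m')
    {κ : ℝ} (hκ : 0 < κ) (hGB : IsGramBoundedR ((LinearMap.toMatrix' f).transpose * C * LinearMap.toMatrix' f) κ)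
    {α : ℝ} (hα : 0 < α)
    (hrow : ∀ X, ∑ Y, ‖((LinearMap.toMatrix' f).transpose * C * LinearMap.toMatrix' f) X Y‖ ≤ α)
    (hcol : ∀ Y, ∑ X, ‖((LinearMap.toMatrix' f).transpose * C * LinearMap.toMatrix' f) X Y‖ ≤ α)
    {ρ : ℝ} (hρ : 0 < ρ) (hθ : Real.exp 1 * α * normV Γ' κ ρ μ / κ ^ 2 < 1)
    {cr cc : ℝ} (hcr0 : 0 ≤ cr) (hcc0 : 0 ≤ cc)
    (hrow' : ∀ X'', ∑ X', ‖(LinearMap.toMatrix' g * LinearMap.toMatrix' f) X'' X'‖ ≤ cr)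
    (hcol' : ∀ X', ∑ X'', ‖(LinearMap.toMatrix' g * LinearMap.toMatrix' f) X'' X'‖ ≤ cc)
    {ε : ℝ} (hε : 0 ≤ ε) {N₀ : ℕ} (hN₀ : 2 ≤ N₀) (m : ℕ) :
    kernelNorm ε (m + 1) (kernel 𝕜 (ExteriorAlgebra.map g
        ((effAction 𝕜 C (ExteriorAlgebra.map f Vt) - gaussConv 𝕜 C (ExteriorAlgebra.map f Vt)) -
          (effAction 𝕜 C (ExteriorAlgebra.map f Vt') - gaussConv 𝕜 C (ExteriorAlgebra.map f Vt')))) (m + 1)) ≤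
      cr * cc ^ m * ε ^ m *
        (∑ n ∈ Ico 2 N₀, (ρ⁻¹ ^ (m + 1) * κ⁻¹ ^ (2 * (n - 1)) * (α ^ (n - 1) * Real.exp n)) *
            ∑ δ ∈ (Fintype.piFinset fun _ : Fin n => range (Fintype.card Γ' / 2 + 1)) with m + 1 + 2 * (n - 1) ≤ ∑ a, 2 * δ a,
              ∑ a, (Real.exp 2 * (κ + ρ)) ^ (2 * δ a) * ν (δ a) *
                ∏ b ∈ univ.erase a, (Real.exp 2 * (κ + ρ)) ^ (2 * δ b) * μ (δ b) +
          2 * (ρ⁻¹ ^ (m + 1) * (Real.exp 1 * normV Γ' κ ρ μ) *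
            (Real.exp 1 * α * normV Γ' κ ρ μ / κ ^ 2) ^ (N₀ - 1) / (1 - Real.exp 1 * α * normV Γ' κ ρ μ / κ ^ 2))) := by
  set C' : Matrix Γ' Γ' 𝕜 := (LinearMap.toMatrix' f).transpose * C * LinearMap.toMatrix' f with hC'
  set nV : ℝ := normV Γ' κ ρ μ with hnV
  -- the pinned input profiles from the `kernelNorm 1` profiles
  have hμp : ∀ m' (j : Fin (2 * m')) (w : Γ'),
      ∑ Y ∈ univ.filter (fun Y : Fin (2 * m') → Γ' => Y j = w), ‖kernel 𝕜 Vt (2 * m') Y‖ ≤ μ m' :=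
    fun m' j w => (pinnedSum_le_kernelNorm_one _ j w).trans (hμ m')
  have hμp' : ∀ m' (j : Fin (2 * m')) (w : Γ'),
      ∑ Y ∈ univ.filter (fun Y : Fin (2 * m') → Γ' => Y j = w), ‖kernel 𝕜 Vt' (2 * m') Y‖ ≤ μ m' :=
    fun m' j w => (pinnedSum_le_kernelNorm_one _ j w).trans (hμ' m')
  have hνp : ∀ m' (j : Fin (2 * m')) (w : Γ'), ∑ Y ∈ univ.filter (fun Y : Fin (2 * m') → Γ' => Y j = w),
      ‖kernel 𝕜 Vt (2 * m') Y - kernel 𝕜 Vt' (2 * m') Y‖ ≤ ν m' := by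
    intro m' j w
    have h := (pinnedSum_le_kernelNorm_one (kernel 𝕜 (Vt - Vt') (2 * m')) j w).trans (hν m')
    simpa only [kernel_sub_eq] using h
  -- the graded telescoped abstract bound in the auxiliary representation
  have hgraded := sum_norm_kernel_effAction_sub_gaussConv_sub_le_graded_of_gramBounded C' hκ hGB Vt Vt' hVt hVt' hVt0 hVt'0 μ ν
    hμ0 hν0 hμp hμp' hνp hα hrow hcol hρ hθ hN₀ (Nat.succ_pos m)
  have hnV0 : 0 ≤ nV := normV_nonneg hκ.le hρ.le hμ0
  have hθ0 : 0 ≤ Real.exp 1 * α * nV / κ ^ 2 := by positivity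
  set B : ℝ := ∑ n ∈ Ico 2 N₀, (ρ⁻¹ ^ (m + 1) * κ⁻¹ ^ (2 * (n - 1)) * (α ^ (n - 1) * Real.exp n)) *
      ∑ δ ∈ (Fintype.piFinset fun _ : Fin n => range (Fintype.card Γ' / 2 + 1)) with m + 1 + 2 * (n - 1) ≤ ∑ a, 2 * δ a,
        ∑ a, (Real.exp 2 * (κ + ρ)) ^ (2 * δ a) * ν (δ a) * ∏ b ∈ univ.erase a, (Real.exp 2 * (κ + ρ)) ^ (2 * δ b) * μ (δ b) +
    2 * (ρ⁻¹ ^ (m + 1) * (Real.exp 1 * nV) * (Real.exp 1 * α * nV / κ ^ 2) ^ (N₀ - 1) / (1 - Real.exp 1 * α * nV / κ ^ 2)) with hB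
  have hB0 : 0 ≤ B := by
    refine add_nonneg (sum_nonneg fun n _ => mul_nonneg (by positivity) (sum_nonneg fun δ _ => sum_nonneg fun a _ => ?_))
      (mul_nonneg zero_le_two (div_nonneg (by positivity) (by linarith)))
    exact mul_nonneg (mul_nonneg (by positivity) (hν0 _)) (prod_nonneg fun b _ => mul_nonneg (by positivity) (hμ0 _))
  have haux : kernelNorm 1 (m + 1) (kernel 𝕜 ((effAction 𝕜 C' Vt - gaussConv 𝕜 C' Vt) -
      (effAction 𝕜 C' Vt' - gaussConv 𝕜 C' Vt')) (m + 1)) ≤ B :=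
    kernelNorm_succ_le_of_forall 1 m _ hB0 fun i w => by
      rw [one_pow, one_mul]
      exact hgraded i w
  -- read through `g ∘ f`
  have hsub : (effAction 𝕜 C (ExteriorAlgebra.map f Vt) - gaussConv 𝕜 C (ExteriorAlgebra.map f Vt)) -
      (effAction 𝕜 C (ExteriorAlgebra.map f Vt') - gaussConv 𝕜 C (ExteriorAlgebra.map f Vt')) =
      ExteriorAlgebra.map f ((effAction 𝕜 C' Vt - gaussConv 𝕜 C' Vt) - (effAction 𝕜 C' Vt' - gaussConv 𝕜 C' Vt')) := by
    rw [effAction_map 𝕜 f C Vt, gaussConv_map 𝕜 f C Vt, effAction_map 𝕜 f C Vt', gaussConv_map 𝕜 f C Vt', map_sub, map_sub,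
      map_sub]
  rw [hsub, map_map_eq_map_comp, kernelNorm_eq_pow_mul_kernelNorm_one hε]
  have hY := kernelNorm_kernel_map_le (g ∘ₗ f) hcr0 hcc0 (ε := 1)
    (by intro X''; rw [LinearMap.toMatrix'_comp]; exact hrow' X'')
    (by intro X'; simp only [LinearMap.toMatrix'_comp]; exact hcol' X') zero_le_one
    ((effAction 𝕜 C' Vt - gaussConv 𝕜 C' Vt) - (effAction 𝕜 C' Vt' - gaussConv 𝕜 C' Vt')) m
  calc ε ^ m * kernelNorm 1 (m + 1) (kernel 𝕜 (ExteriorAlgebra.map (g ∘ₗ f)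
        ((effAction 𝕜 C' Vt - gaussConv 𝕜 C' Vt) - (effAction 𝕜 C' Vt' - gaussConv 𝕜 C' Vt'))) (m + 1))
      ≤ ε ^ m * (cr * cc ^ m * kernelNorm 1 (m + 1) (kernel 𝕜 ((effAction 𝕜 C' Vt - gaussConv 𝕜 C' Vt) -
          (effAction 𝕜 C' Vt' - gaussConv 𝕜 C' Vt')) (m + 1))) :=
        mul_le_mul_of_nonneg_left hY (pow_nonneg hε _)
    _ ≤ ε ^ m * (cr * cc ^ m * B) := mul_le_mul_of_nonneg_left (mul_le_mul_of_nonneg_left haux (by positivity)) (pow_nonneg hε _)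
    _ = cr * cc ^ m * ε ^ m * B := by ring

end Generic

/-! ### §2 The Hubbard torus: linearity of the sector preimage and the plateau transfer -/

section Transfer

open scoped InnerProductSpace

variable {L M : ℕ} [NeZero L] {N N' : ℕ}

/-- The sector preimage is additive in `G` (private helper; the public linear-map form lives with the two-volume kit). [folklore] -/
private theorem sectorPreimage_add (β : ℝ) (F : Fin N → FreqMomentum L M → ℂ) (G G' : HubbardGrassmann L M) :
    sectorPreimage β F (G + G') = sectorPreimage β F G + sectorPreimage β F G' := by
  unfold sectorPreimage
  rw [← sum_add_distrib]
  refine sum_congr rfl fun m _ => ?_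
  rw [← presented_add]
  congr 1
  funext Y
  simp only [Pi.add_apply, sectorisedKernel_add, mul_add]

/-- The sector preimage is homogeneous in `G` (private helper). [folklore] -/
private theorem sectorPreimage_smul (β : ℝ) (F : Fin N → FreqMomentum L M → ℂ) (c : ℂ) (G : HubbardGrassmann L M) :
    sectorPreimage β F (c • G) = c • sectorPreimage β F G := by
  unfold sectorPreimage
  rw [smul_sum]
  refine sum_congr rfl fun m _ => ?_
  rw [← presented_smul]
  congr 1
  funext Y
  simp only [Pi.smul_apply, sectorisedKernel_smul, smul_eq_mul]
  ring

/-- The sector preimage of a difference (private helper). [folklore] -/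
private theorem sectorPreimage_sub (β : ℝ) (F : Fin N → FreqMomentum L M → ℂ) (G G' : HubbardGrassmann L M) :
    sectorPreimage β F (G - G') = sectorPreimage β F G - sectorPreimage β F G' := by
  rw [sub_eq_add_neg, ← neg_one_smul ℂ G', sectorPreimage_add, sectorPreimage_smul, neg_one_smul, ← sub_eq_add_neg]

variable [NeZero M]

/-- **The orders `≥ 2` of the increment DIFFERENCE of the sectorised kernels of two inputs across one slice, GRADED and TELESCOPED**
(BGM 2006 (2.61)–(2.63), (2.66), (2.77)–(2.83), (2.87)–(2.90); Gawȩdzki–Kupiainen 1985 §3): data as in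
`hubbardSectorKernelNorm_effAction_sub_gaussConv_le_graded_of_gramBounded_of_plateau` for TWO even inputs `G, G′` without constant part
(thin/fat families `F, F̃` with `F̃F = F`, `ΣF = 0 ⇒ F = 0`, plateau of `F` over the covariance `C` and over the output family `F′`, sectorised
covariance `S(F̃)ᵀ C S(F̃)` replica-Gram-bounded with `κ > 0` and row/column sums `≤ α`, radius `ρ`, overlap costs `(cr, cc)`), a COMMON majorant
profile `μ̄ ≥ 0` of `ε_x‖G‖_{F,univ,2m′}` and `ε_x‖G′‖_{F,univ,2m′}` with `θ̄ = eα‖μ̄‖_h/κ² < 1`, a difference profile `ν̄ ≥ 0` of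
`ε_x‖G − G′‖_{F,univ,2m′}`, truncation order `N₀ ≥ 2`; then in every degree `m + 1` and for every constraint set `A`,
`‖(effAction C G − e^{Δ_C}G) − (effAction C G′ − e^{Δ_C}G′)‖_{F′, A, m+1} ≤
  cr cc^m ε_x^m [ Σ_{n=2}^{N₀−1} ρ^{-(m+1)} κ^{-2(n−1)} α^{n−1} eⁿ Σ_{δ ∈ [0,|Γ′|/2]^n, m+1+2(n−1) ≤ Σ 2δ_a} Σ_a g_ν̄(δ_a) Π_{b≠a} g_μ̄(δ_b)
    + 2ρ^{-(m+1)} e‖μ̄‖_h θ̄^{N₀−1}/(1−θ̄) ]`, `Γ′ = SpaceTimeIdx × SectorLeg N` — the Lipschitz constant of the orders `≥ 2` born across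
the slice keeps the leg constraint, hence the perturbative order, with ONE slot carrying the difference.
[cite: BenfattoGiulianiMastropietro2006, (2.61)-(2.63), (2.66), (2.87)-(2.90)] -/
theorem hubbardSectorKernelNorm_effAction_sub_gaussConv_sub_le_graded_of_gramBounded_of_plateau
    {β : ℝ} (hβ : 0 < β) (F Ft : Fin N → FreqMomentum L M → ℂ) (hFF : ∀ ω k, Ft ω k * F ω k = F ω k)
    (hF0 : ∀ k, ∑ ω, F ω k = 0 → ∀ ω, F ω k = 0)
    (F' : Fin N' → FreqMomentum L M → ℂ) (G G' : HubbardGrassmann L M) (hG : G ∈ evenPart ℂ (HubbardFieldIdx L M))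
    (hG' : G' ∈ evenPart ℂ (HubbardFieldIdx L M)) (hG0 : constPart ℂ G = 0) (hG'0 : constPart ℂ G' = 0)
    (C : Matrix (HubbardFieldIdx L M) (HubbardFieldIdx L M) ℂ)
    (hCpl : ∀ X Y, C X Y ≠ 0 → ∑ ω, F ω X.1.1 = 1 ∧ ∑ ω, F ω Y.1.1 = 1)
    (hF'pl : ∀ (ω' : Fin N') (k : FreqMomentum L M), F' ω' k ≠ 0 → ∑ ω, F ω k = 1)
    (μ ν : ℕ → ℝ) (hμ0 : ∀ m', 0 ≤ μ m') (hν0 : ∀ m', 0 ≤ ν m')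
    (hμ : ∀ m', imagTimeWeight β M *
      hubbardSectorKernelNorm L M β F (univ : Finset (Fin (2 * m') → SectorLeg N)) G ≤ μ m')
    (hμ' : ∀ m', imagTimeWeight β M *
      hubbardSectorKernelNorm L M β F (univ : Finset (Fin (2 * m') → SectorLeg N)) G' ≤ μ m')
    (hν : ∀ m', imagTimeWeight β M *
      hubbardSectorKernelNorm L M β F (univ : Finset (Fin (2 * m') → SectorLeg N)) (G - G') ≤ ν m')
    {κ : ℝ} (hκ : 0 < κ)
    (hGB : IsGramBoundedR ((sectorSubMatrix L M β Ft).transpose * C * sectorSubMatrix L M β Ft) κ)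
    {α : ℝ} (hα : 0 < α)
    (hrow : ∀ X, ∑ Y, ‖((sectorSubMatrix L M β Ft).transpose * C * sectorSubMatrix L M β Ft) X Y‖ ≤ α)
    (hcol : ∀ Y, ∑ X, ‖((sectorSubMatrix L M β Ft).transpose * C * sectorSubMatrix L M β Ft) X Y‖ ≤ α)
    {ρ : ℝ} (hρ : 0 < ρ) (hθ : Real.exp 1 * α * normV (SpaceTimeIdx L M × SectorLeg N) κ ρ μ / κ ^ 2 < 1)
    {cr cc : ℝ} (hcr0 : 0 ≤ cr) (hcc0 : 0 ≤ cc)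
    (hrow' : ∀ X'', ∑ X', ‖(sectorAnalysisMatrix L M β F' * sectorSubMatrix L M β Ft) X'' X'‖ ≤ cr)
    (hcol' : ∀ X', ∑ X'', ‖(sectorAnalysisMatrix L M β F' * sectorSubMatrix L M β Ft) X'' X'‖ ≤ cc)
    {N₀ : ℕ} (hN₀ : 2 ≤ N₀) (m : ℕ) (A : Finset (Fin (m + 1) → SectorLeg N')) :
    hubbardSectorKernelNorm L M β F' A
        ((effAction ℂ C G - gaussConv ℂ C G) - (effAction ℂ C G' - gaussConv ℂ C G')) ≤
      cr * cc ^ m * imagTimeWeight β M ^ m *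
        (∑ n ∈ Ico 2 N₀, (ρ⁻¹ ^ (m + 1) * κ⁻¹ ^ (2 * (n - 1)) * (α ^ (n - 1) * Real.exp n)) *
            ∑ δ ∈ (Fintype.piFinset fun _ : Fin n => range (Fintype.card (SpaceTimeIdx L M × SectorLeg N) / 2 + 1)) with
                m + 1 + 2 * (n - 1) ≤ ∑ a, 2 * δ a,
              ∑ a, (Real.exp 2 * (κ + ρ)) ^ (2 * δ a) * ν (δ a) *
                ∏ b ∈ univ.erase a, (Real.exp 2 * (κ + ρ)) ^ (2 * δ b) * μ (δ b) +
          2 * (ρ⁻¹ ^ (m + 1) * (Real.exp 1 * normV (SpaceTimeIdx L M × SectorLeg N) κ ρ μ) *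
            (Real.exp 1 * α * normV (SpaceTimeIdx L M × SectorLeg N) κ ρ μ / κ ^ 2) ^ (N₀ - 1) /
            (1 - Real.exp 1 * α * normV (SpaceTimeIdx L M × SectorLeg N) κ ρ μ / κ ^ 2))) := by
  -- the auxiliary representation: profiles of the preimages
  have hμt : ∀ m', kernelNorm 1 (2 * m') (kernel ℂ (sectorPreimage β F G) (2 * m')) ≤ μ m' :=
    fun m' => (kernelNorm_kernel_sectorPreimage_two_mul_le hβ.le F G hG0 m').trans (hμ m')
  have hμt' : ∀ m', kernelNorm 1 (2 * m') (kernel ℂ (sectorPreimage β F G') (2 * m')) ≤ μ m' :=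
    fun m' => (kernelNorm_kernel_sectorPreimage_two_mul_le hβ.le F G' hG'0 m').trans (hμ' m')
  have hνt : ∀ m', kernelNorm 1 (2 * m') (kernel ℂ (sectorPreimage β F G - sectorPreimage β F G') (2 * m')) ≤ ν m' := by
    intro m'
    rw [← sectorPreimage_sub]
    exact (kernelNorm_kernel_sectorPreimage_two_mul_le hβ.le F (G - G') (by rw [map_sub, hG0, hG'0, sub_zero]) m').trans (hν m')
  -- norm of `G`-objects through `E(F′)` and transfer
  refine (hubbardSectorKernelNorm_le_kernelNorm_map hβ.le F' A _).trans ?_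
  have hea := map_sectorAnalysis_effAction_map_sectorPreimage_of_plateau hβ.ne' F Ft hFF hF0 F' G C hCpl hF'pl
  have hgc := map_sectorAnalysis_gaussConv_map_sectorPreimage_of_plateau hβ.ne' F Ft hFF hF0 F' G C hCpl hF'pl
  have hea' := map_sectorAnalysis_effAction_map_sectorPreimage_of_plateau hβ.ne' F Ft hFF hF0 F' G' C hCpl hF'pl
  have hgc' := map_sectorAnalysis_gaussConv_map_sectorPreimage_of_plateau hβ.ne' F Ft hFF hF0 F' G' C hCpl hF'pl
  have hrepl : ExteriorAlgebra.map (Matrix.toLin' (sectorAnalysisMatrix L M β F'))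
      ((effAction ℂ C G - gaussConv ℂ C G) - (effAction ℂ C G' - gaussConv ℂ C G')) =
      ExteriorAlgebra.map (Matrix.toLin' (sectorAnalysisMatrix L M β F'))
        ((effAction ℂ C (ExteriorAlgebra.map (Matrix.toLin' (sectorSubMatrix L M β Ft)) (sectorPreimage β F G)) -
            gaussConv ℂ C (ExteriorAlgebra.map (Matrix.toLin' (sectorSubMatrix L M β Ft)) (sectorPreimage β F G))) -
          (effAction ℂ C (ExteriorAlgebra.map (Matrix.toLin' (sectorSubMatrix L M β Ft)) (sectorPreimage β F G')) -
            gaussConv ℂ C (ExteriorAlgebra.map (Matrix.toLin' (sectorSubMatrix L M β Ft)) (sectorPreimage β F G')))) := by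
    simp only [map_sub, hea, hgc, hea', hgc']
  rw [hrepl]
  have h := kernelNorm_kernel_map_effAction_sub_gaussConv_sub_le_graded_of_gramBounded C (Matrix.toLin' (sectorSubMatrix L M β Ft))
    (Matrix.toLin' (sectorAnalysisMatrix L M β F')) (sectorPreimage β F G) (sectorPreimage β F G') (sectorPreimage_mem_evenPart β F hG)
    (sectorPreimage_mem_evenPart β F hG') (by rw [constPart_sectorPreimage, hG0]) (by rw [constPart_sectorPreimage, hG'0]) μ ν hμ0 hν0
    hμt hμt' hνt hκ (by simpa only [LinearMap.toMatrix'_toLin'] using hGB) hα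
    (by simpa only [LinearMap.toMatrix'_toLin'] using hrow) (by simpa only [LinearMap.toMatrix'_toLin'] using hcol) hρ hθ hcr0 hcc0
    (by simpa only [LinearMap.toMatrix'_toLin'] using hrow') (by simpa only [LinearMap.toMatrix'_toLin'] using hcol')
    (imagTimeWeight_nonneg hβ.le M) hN₀ m
  exact h

end Transfer

/-! ### §3 First order: the Gaussian convolution is linear, so the binomial–Gram door is evaluated at the difference -/

section FirstOrder

variable {L M : ℕ} [NeZero L] [NeZero M] {N N' : ℕ}

/-- **The FIRST-ORDER increment DIFFERENCE of the sectorised kernels across one slice, binomial–Gram form** (BGM 2006 (2.61)–(2.63), (2.66),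
first order): `e^{Δ_C}` is linear, so `(e^{Δ_C}G − G) − (e^{Δ_C}G′ − G′) = e^{Δ_C}(G − G′) − (G − G′)` and the one-input door
`hubbardSectorKernelNorm_gaussConv_sub_le_binomial_of_gramBounded_of_plateau` at the even input `G − G′` gives, for every `p` and every
constraint set `A`, `‖(e^{Δ_C}G − G) − (e^{Δ_C}G′ − G′)‖_{F′,A,2p+2} ≤ cr·cc^{2p+1}·ε_x^{2p+1}·Σ_{m′ > p+1} C(2m′,2p+2)·κ^{2m′−2p−2}·(ε_x‖G − G′‖_{F,univ,2m′})`
— LINEAR in the difference profile (the `towerFO` slot of the Lipschitz tower). [cite: BenfattoGiulianiMastropietro2006, (2.61)-(2.63), (2.66)] -/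
theorem hubbardSectorKernelNorm_gaussConv_sub_sub_le_binomial_of_gramBounded_of_plateau
    {β : ℝ} (hβ : 0 < β) (F Ft : Fin N → FreqMomentum L M → ℂ) (hFF : ∀ ω k, Ft ω k * F ω k = F ω k)
    (hF0 : ∀ k, ∑ ω, F ω k = 0 → ∀ ω, F ω k = 0)
    (F' : Fin N' → FreqMomentum L M → ℂ) (G G' : HubbardGrassmann L M) (hG : G ∈ evenPart ℂ (HubbardFieldIdx L M))
    (hG' : G' ∈ evenPart ℂ (HubbardFieldIdx L M))
    (C : Matrix (HubbardFieldIdx L M) (HubbardFieldIdx L M) ℂ)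
    (hCpl : ∀ X Y, C X Y ≠ 0 → ∑ ω, F ω X.1.1 = 1 ∧ ∑ ω, F ω Y.1.1 = 1)
    (hF'pl : ∀ (ω' : Fin N') (k : FreqMomentum L M), F' ω' k ≠ 0 → ∑ ω, F ω k = 1)
    {κ : ℝ} (hκ : 0 ≤ κ)
    (hGB : IsGramBoundedR ((sectorSubMatrix L M β Ft).transpose * C * sectorSubMatrix L M β Ft) κ)
    {cr cc : ℝ} (hcr0 : 0 ≤ cr) (hcc0 : 0 ≤ cc)
    (hrow' : ∀ X'', ∑ X', ‖(sectorAnalysisMatrix L M β F' * sectorSubMatrix L M β Ft) X'' X'‖ ≤ cr)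
    (hcol' : ∀ X', ∑ X'', ‖(sectorAnalysisMatrix L M β F' * sectorSubMatrix L M β Ft) X'' X'‖ ≤ cc)
    (p : ℕ) (A : Finset (Fin (2 * p + 1 + 1) → SectorLeg N')) :
    hubbardSectorKernelNorm L M β F' A ((gaussConv ℂ C G - G) - (gaussConv ℂ C G' - G')) ≤
      cr * cc ^ (2 * p + 1) * imagTimeWeight β M ^ (2 * p + 1) *
        ∑ m' ∈ range (Fintype.card (SpaceTimeIdx L M × SectorLeg N) / 2 + 1),
          (if p + 1 < m' then ((2 * m').choose (2 * (p + 1)) : ℝ) * κ ^ (2 * m' - 2 * (p + 1)) *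
            (imagTimeWeight β M *
              hubbardSectorKernelNorm L M β F (univ : Finset (Fin (2 * m') → SectorLeg N)) (G - G')) else 0) := by
  have hlin : (gaussConv ℂ C G - G) - (gaussConv ℂ C G' - G') = gaussConv ℂ C (G - G') - (G - G') := by
    rw [map_sub]; abel
  rw [hlin]
  exact hubbardSectorKernelNorm_gaussConv_sub_le_binomial_of_gramBounded_of_plateau hβ F Ft hFF hF0 F' (G - G') (sub_mem hG hG') C hCpl
    hF'pl hκ hGB hcr0 hcc0 hrow' hcol' p A

end FirstOrder

end Literature.MathematicalPhysics.QuantumLattice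

end
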